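import Summits.QuantumFields.YangMills.Theorems.CentreWallReflectionSlabWeights
import Summits.QuantumFields.YangMills.Theorems.CentreWallReflectionWallReflectionRings
import HarnessLib

/-!
# Slab decomposition of the four-torus Wilson weight, VI: ring weights as torus weights; the wall reflection bound on EVEN tori
# (crux `CentreWallReflection.WallReflection` ⟨stmt-QuantumFields-23707⟩, line `birth`, stub `stub_instantiate`; planner ym-idea-4 g18)

Conversions of the abstract ring weights into torus weights (twisted partition function, partition function, flip weight, wall weight), and
`core_even`: on a torus of even side `n + 1 = 2m`, the registered even ring lemma `stub_evenRing` (file `…WallReflectionRings`) with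
`Ψ = Ψ_m`, `T` the centre twist and the label `O ∘ P_ν` gives `Z(z) ≤ √Z(1)·(2√(4ε²Z(1)) + √(ε²Z(1))) = 5εZ(1) ≤ 16εZ(1)`.
HONEST FRAMING: lattice bookkeeping toward ONE crux of a draft route (fixed torus, finite lattice); nothing here proves the route's target
`MarginalTwistOnset.FixedTorusCriterionFailure`, any continuum statement, or the Yang–Mills mass gap.  THEOREMS ONLY (no `def`, no `sorry`),
standard axioms.  References: [cite: OsterwalderSeiler1978, §2]; [cite: tHooft1979]; E. T. Tomboulis, L. G. Yaffe, CMP 100 (1985) 313;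
[cite: Luscher1983, §2].
-/

set_option autoImplicit false

noncomputable section

open scoped BigOperators
open MeasureTheory Literature.MathematicalPhysics.QuantumFieldTheory

namespace Summit.QuantumFields.YangMills.Theorems.CentreWallReflection.Slab

open MeasureTheory
open Literature.MathematicalPhysics.QuantumFieldTheory.LatticeRP (splice measurePreserving_splice measurable_splice)

section Twisted

variable {n : ℕ} {G : Type*} [Group G] [TopologicalSpace G] [IsTopologicalGroup G] [CompactSpace G]
  [MeasurableSpace G] [BorelSpace G] [SecondCountableTopology G] {N : ℕ} (ρ : G →* Matrix (Fin N) (Fin N) ℂ) (μ ν : Fin 4)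


/-! ## §11 The twisted ring identity -/

/-- **Ring identity (twisted).** With `T = twistMap μ ν z` (`z` central, `q = (μ, ν)`):
`∫ H e^{−β Σ_p c^z_p} dπ = ∫dX ∫dA Hb(TX, A) Ψ_j(X, A) Ψ_{n+1−j}(A, TX)`. -/
theorem twisted_ring_identity (hn : 1 ≤ n) (hρ : Continuous ρ) (hU : ∀ g, ρ g ∈ Matrix.unitaryGroup (Fin N) ℂ) {β : ℝ} (hβ : 0 ≤ β)
    {q : {p : Fin 4 × Fin 4 // p.1 < p.2}} (hμ : q.1.1 = μ) (hν : q.1.2 = ν) {z : G} (hz : z ∈ Subgroup.center G)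
    {j : ℕ} (hj1 : 1 ≤ j) (hjn : j ≤ n) {H : (GaugeConfig 4 (n + 1) G) → ℝ} (hHm : Measurable H) {CH : ℝ} (hHb : ∀ W, |H W| ≤ CH)
    {Hb : (GaugeConfig 4 (n + 1) G) → (GaugeConfig 4 (n + 1) G) → ℝ} (hHbm : Measurable (Function.uncurry Hb)) (hH : ∀ U X A, H (glue μ j U X A) = Hb X A) :
    ∫ W, H W * Real.exp (-(β * ∑ p : Plaquette 4 (n + 1), twistedCost ρ q z W p)) ∂(MeasureTheory.Measure.pi (fun _ : Edge 4 (n + 1) => haarProbability G)) =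
      ∫ X, ∫ A, Hb (twistMap μ ν z X) A * (slabKernel ρ μ β j X A * slabKernel ρ μ β (n + 1 - j) A (twistMap μ ν z X)) ∂(MeasureTheory.Measure.pi (fun _ : Edge 4 (n + 1) => haarProbability G)) ∂(MeasureTheory.Measure.pi (fun _ : Edge 4 (n + 1) => haarProbability G)) := by
  have hμν : μ ≠ ν := by rw [← hμ, ← hν]; exact ne_of_lt q.2
  have hCH : 0 ≤ CH := (abs_nonneg _).trans (hHb 1)
  -- the twisted weight is bounded by one: rewrite it through the splitting
  have hsplitW : ∀ W : (GaugeConfig 4 (n + 1) G), ∑ p : Plaquette 4 (n + 1), twistedCost ρ q z W p =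
      slabAction ρ μ j (twistMap μ ν z⁻¹ W) + coSlabAction ρ μ j W := by
    intro W
    rw [sum_twistedCost_eq_slab_add ρ hn hμ hν hz hj1 hjn, coSlabAction_eq_slabAction_translate ρ μ hj1 hjn]
  have hFm : Measurable fun W : (GaugeConfig 4 (n + 1) G) => H W * Real.exp (-(β * ∑ p : Plaquette 4 (n + 1), twistedCost ρ q z W p)) :=
    hHm.mul (Real.continuous_exp.measurable.comp
      ((continuous_finsetSum _ fun p _ => continuous_twistedCost ρ hρ q z p).measurable.const_mul β).neg)
  have hFb : ∀ W : (GaugeConfig 4 (n + 1) G), |H W * Real.exp (-(β * ∑ p : Plaquette 4 (n + 1), twistedCost ρ q z W p))| ≤ CH := by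
    intro W
    rw [abs_mul, hsplitW]
    have h1 : |Real.exp (-(β * (slabAction ρ μ j (twistMap μ ν z⁻¹ W) + coSlabAction ρ μ j W)))| ≤ 1 :=
      abs_exp_neg_le_one hβ (add_nonneg (slabAction_nonneg ρ μ hU j _) (coSlabAction_nonneg ρ μ hU j _))
    calc |H W| * _ ≤ CH * 1 := mul_le_mul (hHb W) h1 (abs_nonneg _) hCH
      _ = CH := mul_one _
  rw [integral_glue μ j hFm hFb]
  -- the inner two integrals, before the substitution `X ↦ T X`
  have hinner : ∀ X : (GaugeConfig 4 (n + 1) G), ∫ A, ∫ U, H (glue μ j U X A) *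
      Real.exp (-(β * ∑ p : Plaquette 4 (n + 1), twistedCost ρ q z (glue μ j U X A) p)) ∂(MeasureTheory.Measure.pi (fun _ : Edge 4 (n + 1) => haarProbability G)) ∂(MeasureTheory.Measure.pi (fun _ : Edge 4 (n + 1) => haarProbability G)) =
      ∫ A, Hb X A * (slabKernel ρ μ β j (twistMap μ ν z⁻¹ X) A * slabKernel ρ μ β (n + 1 - j) A X) ∂(MeasureTheory.Measure.pi (fun _ : Edge 4 (n + 1) => haarProbability G)) := by
    intro X
    refine integral_congr_ae (ae_of_all _ fun A => ?_)
    dsimp only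
    have hsplit : ∀ U : (GaugeConfig 4 (n + 1) G), H (glue μ j U X A) * Real.exp (-(β * ∑ p : Plaquette 4 (n + 1), twistedCost ρ q z (glue μ j U X A) p)) =
        Hb X A * (Real.exp (-(β * slabAction ρ μ j (glue μ j U (twistMap μ ν z⁻¹ X) A))) *
          Real.exp (-(β * coSlabAction ρ μ j (glue μ j U X A)))) := by
      intro U
      rw [hH, hsplitW, twistMap_glue μ ν hμν, mul_add, neg_add, Real.exp_add]
    simp_rw [hsplit]
    rw [integral_const_mul]
    congr 1
    rw [← integral_exp_coSlabAction_glue ρ μ hρ β hj1 hjn X A]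
    refine integral_mul_of_dependsOn (slabInterior μ j) (coSlabEdges μ j) (disjoint_slabInterior_coSlabEdges μ j) ?_ ?_ ?_ ?_
    · exact Real.continuous_exp.measurable.comp ((((continuous_slabAction ρ μ hρ j).measurable.comp
        (measurable_glue_left μ j _ A)).const_mul β).neg)
    · exact Real.continuous_exp.measurable.comp ((((continuous_coSlabAction ρ μ hρ j).measurable.comp
        (measurable_glue_left μ j X A)).const_mul β).neg)
    · have h := dependsOn_glue_of_dependsOn μ (dependsOn_comp (dependsOn_slabAction ρ μ hjn) fun s => Real.exp (-(β * s))) j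
        (twistMap μ ν z⁻¹ X) A
      exact h.mono (by exact_mod_cast slabEdges_filter_subset_interior μ j)
    · have h := dependsOn_glue_of_dependsOn μ (dependsOn_comp (dependsOn_coSlabAction ρ μ j) fun s => Real.exp (-(β * s))) j X A
      exact h.mono (by exact_mod_cast coSlabEdges_filter_subset (μ := μ) (j := j))
  simp_rw [hinner]
  -- substitute `X ↦ T X`
  have hKm : Measurable fun X : (GaugeConfig 4 (n + 1) G) => ∫ A, Hb (twistMap μ ν z X) A *
      (slabKernel ρ μ β j X A * slabKernel ρ μ β (n + 1 - j) A (twistMap μ ν z X)) ∂(MeasureTheory.Measure.pi (fun _ : Edge 4 (n + 1) => haarProbability G)) := by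
    have hT : Measurable (twistMap (n := n) μ ν z) := (measurePreserving_twistMap μ ν z).measurable
    have hA : Measurable fun p : (GaugeConfig 4 (n + 1) G) × (GaugeConfig 4 (n + 1) G) => Hb (twistMap μ ν z p.1) p.2 := hHbm.comp ((hT.comp measurable_fst).prodMk measurable_snd)
    have hB : Measurable fun p : (GaugeConfig 4 (n + 1) G) × (GaugeConfig 4 (n + 1) G) => slabKernel ρ μ β j p.1 p.2 :=
      measurable_slabKernel_comp ρ μ hρ β j measurable_fst measurable_snd
    have hC : Measurable fun p : (GaugeConfig 4 (n + 1) G) × (GaugeConfig 4 (n + 1) G) => slabKernel ρ μ β (n + 1 - j) p.2 (twistMap μ ν z p.1) :=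
      measurable_slabKernel_comp ρ μ hρ β (n + 1 - j) measurable_snd (hT.comp measurable_fst)
    have hm : Measurable fun p : (GaugeConfig 4 (n + 1) G) × (GaugeConfig 4 (n + 1) G) => Hb (twistMap μ ν z p.1) p.2 *
        (slabKernel ρ μ β j p.1 p.2 * slabKernel ρ μ β (n + 1 - j) p.2 (twistMap μ ν z p.1)) := hA.mul (hB.mul hC)
    exact (hm.stronglyMeasurable.integral_prod_right' (ν := (MeasureTheory.Measure.pi (fun _ : Edge 4 (n + 1) => haarProbability G)))).measurable
  rw [← integral_comp_mp (measurePreserving_twistMap μ ν z⁻¹) hKm]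
  refine integral_congr_ae (ae_of_all _ fun X => ?_)
  dsimp only
  rw [twistMap_twistMap, mul_inv_cancel, twistMap_one]

end Twisted

end Summit.QuantumFields.YangMills.Theorems.CentreWallReflection.Slab

namespace Summit.QuantumFields.YangMills.Theorems.CentreWallReflection.Slab

open MeasureTheory

/-! ## §16 From ring weights back to torus weights -/

section Conversions

open Summit.QuantumFields.YangMills.Theorems.FemtoTransferGap.FluxReflection (abs_ind_le_one)

variable {n : ℕ} {G : Type*} [Group G] [TopologicalSpace G] [IsTopologicalGroup G] [CompactSpace G]
  [MeasurableSpace G] [BorelSpace G] [SecondCountableTopology G] {N : ℕ} (ρ : G →* Matrix (Fin N) (Fin N) ℂ) (μ ν : Fin 4)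


/-- The twisted partition function as a twisted ring weight. -/
theorem twistedPartition_eq_ring (hn : 1 ≤ n) (hρ : Continuous ρ) (hU : ∀ g, ρ g ∈ Matrix.unitaryGroup (Fin N) ℂ) {β : ℝ} (hβ : 0 ≤ β)
    {q : {p : Fin 4 × Fin 4 // p.1 < p.2}} (hμ : q.1.1 = μ) (hν : q.1.2 = ν) {z : G} (hz : z ∈ Subgroup.center G)
    {j : ℕ} (hj1 : 1 ≤ j) (hjn : j ≤ n) :
    ∫ W, Real.exp (-(β * ∑ p : Plaquette 4 (n + 1), twistedCost ρ q z W p)) ∂(MeasureTheory.Measure.pi (fun _ : Edge 4 (n + 1) => haarProbability G)) =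
      ∫ X, ∫ A, slabKernel ρ μ β j X A * slabKernel ρ μ β (n + 1 - j) A (twistMap μ ν z X) ∂(MeasureTheory.Measure.pi (fun _ : Edge 4 (n + 1) => haarProbability G)) ∂(MeasureTheory.Measure.pi (fun _ : Edge 4 (n + 1) => haarProbability G)) := by
  have h := twisted_ring_identity ρ μ ν hn hρ hU hβ hμ hν hz hj1 hjn (H := fun _ => (1 : ℝ)) measurable_const (CH := 1)
    (fun _ => by simp) (Hb := fun _ _ => (1 : ℝ)) measurable_const (fun _ _ _ => rfl)
  simpa only [one_mul] using h

/-- The partition function as a ring weight. -/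
theorem partition_eq_ring (hρ : Continuous ρ) (hU : ∀ g, ρ g ∈ Matrix.unitaryGroup (Fin N) ℂ) {β : ℝ} (hβ : 0 ≤ β)
    {j : ℕ} (hj1 : 1 ≤ j) (hjn : j ≤ n) :
    ∫ W, boltz ρ β W ∂(MeasureTheory.Measure.pi (fun _ : Edge 4 (n + 1) => haarProbability G)) = ∫ X, ∫ A, slabKernel ρ μ β j X A * slabKernel ρ μ β (n + 1 - j) A X ∂(MeasureTheory.Measure.pi (fun _ : Edge 4 (n + 1) => haarProbability G)) ∂(MeasureTheory.Measure.pi (fun _ : Edge 4 (n + 1) => haarProbability G)) := by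
  have h := ring_identity ρ μ hρ hU hβ hj1 hjn (H := fun _ => (1 : ℝ)) measurable_const (CH := 1)
    (fun _ => by simp) (Hb := fun _ _ => (1 : ℝ)) (fun _ _ _ => rfl)
  simpa only [one_mul, boltz] using h

/-- The flip ring weight is the periodic weight of a label change between slices `0` and `j`. -/
theorem flipRing_eq (hρ : Continuous ρ) (hU : ∀ g, ρ g ∈ Matrix.unitaryGroup (Fin N) ℂ) (hμν : μ ≠ ν) {β : ℝ} (hβ : 0 ≤ β)
    {j : ℕ} (hj1 : 1 ≤ j) (hjn : j ≤ n) {O : G → ℕ} (hOm : Measurable O) :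
    ∫ X, ∫ A, slabKernel ρ μ β j X A * {B : (GaugeConfig 4 (n + 1) G) | O (polyakov μ ν 0 B) ≠ O (polyakov μ ν 0 X)}.indicator (fun _ => (1 : ℝ)) A *
        slabKernel ρ μ β (n + 1 - j) A X ∂(MeasureTheory.Measure.pi (fun _ : Edge 4 (n + 1) => haarProbability G)) ∂(MeasureTheory.Measure.pi (fun _ : Edge 4 (n + 1) => haarProbability G)) =
      ∫ W, {W : (GaugeConfig 4 (n + 1) G) | O (polyakov μ ν j W) ≠ O (polyakov μ ν 0 W)}.indicator (fun _ => (1 : ℝ)) W * boltz ρ β W ∂(MeasureTheory.Measure.pi (fun _ : Edge 4 (n + 1) => haarProbability G)) := by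
  have hHm : Measurable fun W : (GaugeConfig 4 (n + 1) G) => {W : (GaugeConfig 4 (n + 1) G) | O (polyakov μ ν j W) ≠ O (polyakov μ ν 0 W)}.indicator (fun _ => (1 : ℝ)) W :=
    measurable_const.indicator ((measurableSet_eq_fun (hOm.comp (measurable_polyakov μ ν j))
      (hOm.comp (measurable_polyakov μ ν 0))).compl)
  have h := ring_identity ρ μ hρ hU hβ hj1 hjn hHm (CH := 1) (fun W => abs_ind_le_one _ W)
    (Hb := fun X A => {B : (GaugeConfig 4 (n + 1) G) | O (polyakov μ ν 0 B) ≠ O (polyakov μ ν 0 X)}.indicator (fun _ => (1 : ℝ)) A) ?_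
  · rw [show (fun W => {W : (GaugeConfig 4 (n + 1) G) | O (polyakov μ ν j W) ≠ O (polyakov μ ν 0 W)}.indicator (fun _ => (1 : ℝ)) W * boltz ρ β W) =
        fun W => {W : (GaugeConfig 4 (n + 1) G) | O (polyakov μ ν j W) ≠ O (polyakov μ ν 0 W)}.indicator (fun _ => (1 : ℝ)) W *
          Real.exp (-(β * ∑ p : Plaquette 4 (n + 1), plaqCost ρ W p)) from rfl, h]
    refine integral_congr_ae (ae_of_all _ fun X => integral_congr_ae (ae_of_all _ fun A => ?_))
    dsimp only; ring
  · intro U X A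
    simp only [Set.indicator_apply, Set.mem_setOf_eq, polyakov_zero_glue hμν, polyakov_glue_sliceJ hμν hj1 hjn]

/-- The wall ring weight (insertion at the base point) is the wall weight of slice `0`. -/
theorem wallRing_eq (hρ : Continuous ρ) (hU : ∀ g, ρ g ∈ Matrix.unitaryGroup (Fin N) ℂ) (hμν : μ ≠ ν) {β : ℝ} (hβ : 0 ≤ β)
    {j : ℕ} (hj1 : 1 ≤ j) (hjn : j ≤ n) {Wset : Set G} (hWm : MeasurableSet Wset) :
    ∫ X, ∫ A, slabKernel ρ μ β j X A * {B : (GaugeConfig 4 (n + 1) G) | polyakov μ ν 0 B ∈ Wset}.indicator (fun _ => (1 : ℝ)) X *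
        slabKernel ρ μ β (n + 1 - j) A X ∂(MeasureTheory.Measure.pi (fun _ : Edge 4 (n + 1) => haarProbability G)) ∂(MeasureTheory.Measure.pi (fun _ : Edge 4 (n + 1) => haarProbability G)) = wallWeight (n := n) ρ μ ν β Wset 0 := by
  have hHm : Measurable fun W : (GaugeConfig 4 (n + 1) G) => Wset.indicator (fun _ => (1 : ℝ)) (polyakov μ ν 0 W) :=
    (measurable_const.indicator hWm).comp (measurable_polyakov μ ν 0)
  have h := ring_identity ρ μ hρ hU hβ hj1 hjn hHm (CH := 1) (fun W => abs_ind_le_one _ _)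
    (Hb := fun X _ => {B : (GaugeConfig 4 (n + 1) G) | polyakov μ ν 0 B ∈ Wset}.indicator (fun _ => (1 : ℝ)) X) ?_
  · unfold wallWeight boltz
    rw [h]
    refine integral_congr_ae (ae_of_all _ fun X => integral_congr_ae (ae_of_all _ fun A => ?_))
    dsimp only; ring
  · intro U X A
    rw [polyakov_zero_glue hμν]
    by_cases h : polyakov μ ν 0 X ∈ Wset
    · rw [Set.indicator_of_mem h, Set.indicator_of_mem (show X ∈ {B : (GaugeConfig 4 (n + 1) G) | polyakov μ ν 0 B ∈ Wset} from h)]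
    · rw [Set.indicator_of_notMem h, Set.indicator_of_notMem (show X ∉ {B : (GaugeConfig 4 (n + 1) G) | polyakov μ ν 0 B ∈ Wset} from h)]

end Conversions

/-! ## §17 The even ring on the lattice -/

section EvenCore

variable {n : ℕ} {G : Type} [Group G] [TopologicalSpace G] [IsTopologicalGroup G] [CompactSpace G]
  [MeasurableSpace G] [BorelSpace G] [SecondCountableTopology G] {N : ℕ} (ρ : G →* Matrix (Fin N) (Fin N) ℂ) (μ ν : Fin 4)


/-- **The wall reflection bound on an even torus** (`n + 1 = 2m`): `Z(z) ≤ 16 ε Z(1)` from the even ring lemma `stub_evenRing`. -/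
theorem core_even (hE : EvenRingP) (hn : 1 ≤ n) {m : ℕ} (hm : n + 1 = 2 * m) (hρ : Continuous ρ)
    (hU : ∀ g, ρ g ∈ Matrix.unitaryGroup (Fin N) ℂ) {q : {p : Fin 4 × Fin 4 // p.1 < p.2}} (hμ : q.1.1 = μ) (hν : q.1.2 = ν)
    {z : G} (hz : z ∈ Subgroup.center G) {O : G → ℕ} {Wset : Set G} {δ ε β : ℝ} (hOm : Measurable O) (hWm : MeasurableSet Wset)
    (hOc : ∀ g h : G, O (h * g * h⁻¹) = O g) (hWc : ∀ g h : G, h * g * h⁻¹ ∈ Wset ↔ g ∈ Wset)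
    (hsep : ∀ g : G, g ∉ Wset → O (z * g) ≠ O g)
    (hloc : ∀ g g' : G, (N : ℝ) - (ρ (g⁻¹ * g')).trace.re < δ → g ∉ Wset → g' ∉ Wset → O g = O g')
    (hε : 0 < ε) (hβ : 0 ≤ β)
    (hwall : ∑ t ∈ Finset.range (n + 1), wallWeight (n := n) ρ μ ν β Wset t ≤ ε ^ 2 * ∫ W, boltz ρ β W ∂(MeasureTheory.Measure.pi (fun _ : Edge 4 (n + 1) => haarProbability G)))
    (hpin : (((n + 1 : ℕ) : ℝ) ^ 2) * Real.exp (-((δ / (((n + 1 : ℕ) : ℝ) ^ 2)) * β)) ≤ ε ^ 2 * ∫ W, boltz ρ β W ∂(MeasureTheory.Measure.pi (fun _ : Edge 4 (n + 1) => haarProbability G))) :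
    ∫ W, Real.exp (-(β * ∑ p : Plaquette 4 (n + 1), twistedCost ρ q z W p)) ∂(MeasureTheory.Measure.pi (fun _ : Edge 4 (n + 1) => haarProbability G)) ≤ 16 * ε * ∫ W, boltz ρ β W ∂(MeasureTheory.Measure.pi (fun _ : Edge 4 (n + 1) => haarProbability G)) := by
  have hμν : μ < ν := by rw [← hμ, ← hν]; exact q.2
  have hμν' : μ ≠ ν := ne_of_lt hμν
  have hm1 : 1 ≤ m := by omega
  have hmn : m ≤ n := by omega
  have hcm : n + 1 - m = m := by omega
  set Z₁ : ℝ := ∫ W, boltz ρ β W ∂(MeasureTheory.Measure.pi (fun _ : Edge 4 (n + 1) => haarProbability G)) with hZ₁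
  have hZ₁0 : 0 ≤ Z₁ := integral_nonneg fun W => (boltz_pos ρ β W).le
  -- the abstract even ring lemma
  have habs := hE (GaugeConfig 4 (n + 1) G) (MeasureTheory.Measure.pi (fun _ : Edge 4 (n + 1) => haarProbability G)) (slabKernel ρ μ β m) 1 (measurable_slabKernel_comp ρ μ hρ β m measurable_fst measurable_snd)
    (abs_slabKernel_le_one ρ μ hU hβ m) (slabKernel_nonneg ρ μ β m) (slabKernel_symm ρ μ hρ hU β hm1 hmn)
    (twistMap μ ν z) (measurePreserving_twistMap μ ν z) (fun X => O (polyakov μ ν 0 X)) {X : (GaugeConfig 4 (n + 1) G) | polyakov μ ν 0 X ∈ Wset}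
    (hOm.comp (measurable_polyakov μ ν 0)) (hWm.preimage (measurable_polyakov μ ν 0)) (fun X hX => by
      simp only [Set.mem_setOf_eq] at hX
      show O (polyakov μ ν 0 (twistMap μ ν z X)) ≠ O (polyakov μ ν 0 X)
      rw [polyakov_zero_twistMap]; exact hsep _ hX)
  -- identify the four ring weights
  have e1 := twistedPartition_eq_ring ρ μ ν hn hρ hU hβ hμ hν hz hm1 hmn
  have e2 := partition_eq_ring ρ μ hρ hU hβ hm1 hmn
  have e3 := flipRing_eq ρ μ ν hρ hU hμν' hβ hm1 hmn hOm
  have e4 := wallRing_eq ρ μ ν hρ hU hμν' hβ hm1 hmn hWm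
  rw [hcm] at e1 e2 e3 e4
  rw [← e1, ← e2, e3, e4] at habs
  -- the torus bounds
  have hF : ∫ W, {W : (GaugeConfig 4 (n + 1) G) | O (polyakov μ ν m W) ≠ O (polyakov μ ν 0 W)}.indicator (fun _ => (1 : ℝ)) W * boltz ρ β W ∂(MeasureTheory.Measure.pi (fun _ : Edge 4 (n + 1) => haarProbability G)) ≤
      4 * ε ^ 2 * Z₁ := by
    have h1 := integral_flip_le (n := n) ρ μ ν hρ hU hμν hβ hOm hWm hOc hWc hloc m
    have h2 := sum_wallWeight_shift_le ρ μ ν β Wset hmn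
    have h3 : (m : ℝ) * ((n + 1 : ℕ) : ℝ) * Real.exp (-(β * (δ / (((n + 1 : ℕ) : ℝ) ^ 2)))) ≤ ε ^ 2 * Z₁ / 2 := by
      have e : (m : ℝ) * ((n + 1 : ℕ) : ℝ) = (((n + 1 : ℕ) : ℝ) ^ 2) / 2 := by
        have : ((n + 1 : ℕ) : ℝ) = 2 * (m : ℝ) := by exact_mod_cast hm
        rw [this]; ring
      rw [e, mul_comm β, div_mul_eq_mul_div]
      linarith [hpin]
    have hε2 : 0 ≤ ε ^ 2 * Z₁ := by positivity
    linarith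
  have hN0 : wallWeight (n := n) ρ μ ν β Wset 0 ≤ ε ^ 2 * Z₁ :=
    (Finset.single_le_sum (fun t _ => wallWeight_nonneg (n := n) ρ μ ν β Wset t)
      (Finset.mem_range.mpr (Nat.succ_pos n))).trans hwall
  -- square roots
  have hsF : Real.sqrt (∫ W, {W : (GaugeConfig 4 (n + 1) G) | O (polyakov μ ν m W) ≠ O (polyakov μ ν 0 W)}.indicator (fun _ => (1 : ℝ)) W * boltz ρ β W ∂(MeasureTheory.Measure.pi (fun _ : Edge 4 (n + 1) => haarProbability G))) ≤
      2 * ε * Real.sqrt Z₁ := by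
    have h : 4 * ε ^ 2 * Z₁ = (2 * ε * Real.sqrt Z₁) ^ 2 := by rw [mul_pow, mul_pow, Real.sq_sqrt hZ₁0]; ring
    calc _ ≤ Real.sqrt (4 * ε ^ 2 * Z₁) := Real.sqrt_le_sqrt hF
      _ = 2 * ε * Real.sqrt Z₁ := by rw [h, Real.sqrt_sq (by positivity)]
  have hsN : Real.sqrt (wallWeight (n := n) ρ μ ν β Wset 0) ≤ ε * Real.sqrt Z₁ := by
    have h : ε ^ 2 * Z₁ = (ε * Real.sqrt Z₁) ^ 2 := by rw [mul_pow, Real.sq_sqrt hZ₁0]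
    calc _ ≤ Real.sqrt (ε ^ 2 * Z₁) := Real.sqrt_le_sqrt hN0
      _ = ε * Real.sqrt Z₁ := by rw [h, Real.sqrt_sq (by positivity)]
  calc ∫ W, Real.exp (-(β * ∑ p : Plaquette 4 (n + 1), twistedCost ρ q z W p)) ∂(MeasureTheory.Measure.pi (fun _ : Edge 4 (n + 1) => haarProbability G))
      ≤ Real.sqrt Z₁ * (2 * (2 * ε * Real.sqrt Z₁) + ε * Real.sqrt Z₁) := by
        refine habs.trans (mul_le_mul_of_nonneg_left ?_ (Real.sqrt_nonneg _))
        linarith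
    _ = 5 * ε * Z₁ := by
        have : Real.sqrt Z₁ * Real.sqrt Z₁ = Z₁ := Real.mul_self_sqrt hZ₁0
        linear_combination (5 * ε) * this
    _ ≤ 16 * ε * Z₁ := by nlinarith

end EvenCore

end Summit.QuantumFields.YangMills.Theorems.CentreWallReflection.Slab

end
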